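import Mathlib
import HarnessLib
import Literature.MathematicalPhysics.QuantumFieldTheory.YangMillsOS
import Summits.QuantumFields.YangMills.Theorems.HypercubicLimit.Negative.NonTrivialityBridge

/-!
# Closure helper for line `Sketch` (coupling response) of crux `HypercubicLimit`: the non-triviality clause
# from a lattice non-triviality floor

Sub-goal `nontrivialClause_of_latticeFloor` (stmt-QuantumFields-16154, registered skeleton
`Cruxes/HypercubicLimit/Lines/Sketch.lean`).  If the lattice `n`-point functions of the renormalised curvature
field converge to the one-field continuum family `S₁` on real off-diagonal tensors (the crux's convergence
clause, verbatim, for the one-field family) and the truncated lattice two-point function on ONE real pair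
`u` (negative times) `⊗ v` (positive times) stays `≥ δ > 0` eventually along the scheme, then `S₁` satisfies
the crux's non-triviality clause: pass to the limit in the truncated combination (`n = 2` on `u ⊗ v`,
`n = 1` on `u`, `v`; one-point functions are automatically in `⁰𝒮`), get
`δ ≤ ‖S₁ 2 (u ⊗ v) − S₁ 1 (u) S₁ 1 (v)‖`, and conclude with the tree's real certificate
`HypercubicLimit.Negative.twoPointNontrivial_of_real`.
-/

noncomputable section

open scoped SchwartzMap
open MeasureTheory Filter Topology
open Literature.MathematicalPhysics.AQFT Literature.MathematicalPhysics.QuantumLattice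
open Literature.MathematicalPhysics.QuantumFieldTheory
open Summit.QuantumFields.YangMills.Theorems.HypercubicLimit.Negative

namespace Summit.QuantumFields.YangMills.Cruxes.HypercubicLimit.CouplingResponse

-- adapted from `Summit.QuantumFields.YangMills.Theorems.HypercubicLimit.Negative.twoPointNontrivial_iff_lattice`
-- (Negative/NonabelianLoadBearing.lean) and `Theorems.OSLegsFromFemtoAndGap.twoPointNontrivial_of_lowerBounds`
-- (LangevinControlUVOSLegsFromFemtoAndGapStubAssemblyNontrivial.lean): same limit passage, one-field family and
-- an eventual floor `δ ≤ |truncated lattice two-point function|` in place of `¬ Tendsto … (𝓝 0)`.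
/-- **Closure helper (non-triviality).**  Under the crux's convergence clause for the one-field family `S₁` of the
renormalised curvature field, an eventual floor `δ > 0` under the truncated LATTICE two-point function on one
real pair `u` (supported in negative times), `v` (positive times) yields the crux's non-triviality clause for
`S₁.toLabelled`: the truncated combination converges to `S₁ 2 (u ⊗ v) − S₁ 1 (u) S₁ 1 (v)`, whose norm is then
`≥ δ`, and `twoPointNontrivial_of_real` turns the real pair into the time-ordered witnesses
`F₁ = u ∘ θ`, `G₁ = v`, `H₁ = u ⊗ v`. [folklore] -/
theorem nontrivialClause_of_latticeFloor : ∀ (G : Type) [Group G] [TopologicalSpace G] [IsTopologicalGroup G] [CompactSpace G] [MeasurableSpace G] [BorelSpace G] (r : LatticeRep G) (sch : SpeciesScheme (YMSpecies G)) (S₁ : SchwingerFamily (EuclideanSpace ℝ (Fin 4))), (∀ (n : ℕ), n ≠ 0 → ∀ (f : Fin n → 𝓢(EuclideanSpace ℝ (Fin 4), ℝ)) (F : 𝓢((Fin n → EuclideanSpace ℝ (Fin 4)), ℂ)), IsTensorOf F (fun i => ofRealTest (f i)) → IsOffDiagonal F → Tendsto (fun k : ℕ => ((latticeSchwinger r.ρ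 sch (fun s => s.F) k n (fun _ => r.curvature) f : ℝ) : ℂ)) atTop (𝓝 (S₁ n F))) → (∃ (u v : 𝓢(EuclideanSpace ℝ (Fin 4), ℝ)) (δ : ℝ), tsupport u ⊆ {y : EuclideanSpace ℝ (Fin 4) | y 0 < 0} ∧ tsupport v ⊆ {y : EuclideanSpace ℝ (Fin 4) | 0 < y 0} ∧ 0 < δ ∧ ∀ᶠ k in atTop, δ ≤ |latticeSchwinger r.ρ sch (fun s => s.F) k (1 + 1) (fun _ => r.curvature) ![u, v] - latticeSchwinger r.ρ sch (fun s => s.F) k 1 (fun _ => r.curvature) ![u] * latticeSchwinger r.ρ sch (fun s => s.F) k 1 (fun _ => r.curvature) ![v]|) → ∃ (F₁ G₁ : 𝓢((Fin 1 → EuclideanSpace ℝ (Fin 4)), ℂ)) (H₁ : 𝓢((Fin (1 + 1) → EuclideanSpace ℝ (Fin 4)), ℂ)), IsTimeOrdered F₁ ∧ IsTimeOrdered G₁ ∧ IsAppendTensorOf H₁ (osAdjoint F₁) G₁ ∧ S₁.toLabelled (1 + 1) (fun _ => ()) H₁ ≠ S₁.toLabelled 1 (fun _ => ()) (osAdjoint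 F₁) * S₁.toLabelled 1 (fun _ => ()) G₁ := by
  intro G _ _ _ _ _ _ r sch S₁ hconv hfloor
  obtain ⟨u, v, δ, hu, hv, hδ, hev⟩ := hfloor
  refine twoPointNontrivial_of_real S₁.toLabelled () hu hv ?_
  show S₁ (1 + 1) (tensor₂ u v) ≠ S₁ 1 (tensor₁ u) * S₁ 1 (tensor₁ v)
  -- one-point test functions are automatically off-diagonal (no pair of distinct indices in `Fin 1`)
  have h1 : ∀ F : 𝓢((Fin 1 → EuclideanSpace ℝ (Fin 4)), ℂ), IsOffDiagonal F := by
    rintro F x ⟨i, j, hij, -⟩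
    exact absurd (Subsingleton.elim i j) hij
  -- the three instances of the convergence clause
  have h2 := hconv (1 + 1) (by norm_num) ![u, v] (tensor₂ u v) (isTensorOf_tensor₂ u v)
    (isOffDiagonal_of_halfSpaces hu hv (isTensorOf_tensor₂ u v))
  have hu1 := hconv 1 one_ne_zero ![u] (tensor₁ u) (isTensorOf_tensor₁ u) (h1 _)
  have hv1 := hconv 1 one_ne_zero ![v] (tensor₁ v) (isTensorOf_tensor₁ v) (h1 _)
  -- the truncated lattice two-point function converges to the truncated continuum value
  have hT : Tendsto (fun k : ℕ =>
      ((latticeSchwinger r.ρ sch (fun s => s.F) k (1 + 1) (fun _ => r.curvature) ![u, v] -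
        latticeSchwinger r.ρ sch (fun s => s.F) k 1 (fun _ => r.curvature) ![u] *
          latticeSchwinger r.ρ sch (fun s => s.F) k 1 (fun _ => r.curvature) ![v] : ℝ) : ℂ)) atTop
      (𝓝 (S₁ (1 + 1) (tensor₂ u v) - S₁ 1 (tensor₁ u) * S₁ 1 (tensor₁ v))) :=
    (h2.sub (hu1.mul hv1)).congr fun k => by push_cast; ring
  -- hence so do the absolute values, and the floor passes to the limit
  have hN : Tendsto (fun k : ℕ =>
      |latticeSchwinger r.ρ sch (fun s => s.F) k (1 + 1) (fun _ => r.curvature) ![u, v] -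
        latticeSchwinger r.ρ sch (fun s => s.F) k 1 (fun _ => r.curvature) ![u] *
          latticeSchwinger r.ρ sch (fun s => s.F) k 1 (fun _ => r.curvature) ![v]|) atTop
      (𝓝 ‖S₁ (1 + 1) (tensor₂ u v) - S₁ 1 (tensor₁ u) * S₁ 1 (tensor₁ v)‖) := by
    simpa only [Complex.norm_real, Real.norm_eq_abs] using hT.norm
  have hge : δ ≤ ‖S₁ (1 + 1) (tensor₂ u v) - S₁ 1 (tensor₁ u) * S₁ 1 (tensor₁ v)‖ :=
    ge_of_tendsto hN hev
  intro heq
  rw [sub_eq_zero.2 heq, norm_zero] at hge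
  exact absurd hge (not_le.2 hδ)

end Summit.QuantumFields.YangMills.Cruxes.HypercubicLimit.CouplingResponse

end
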